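import Summits.CriticalPhenomena.PercolationContinuityZ3.Theorems.TallClusterMassBound.Negative.FalseWithoutCriticality
import Summits.CriticalPhenomena.PercolationContinuityZ3.Theorems.BoundaryTwoArmDecay.Negative.LoadBearing
import Summits.CriticalPhenomena.PercolationContinuityZ3.Theorems.PercLowPointHalfSpaceAssemblyReduction
import Literature.Probability.Percolation.TwoPointFunction

/-!
# `LowPointBookkeeping` (crux K, stmt-CriticalPhenomena-14713) — logical status and load-bearing analysis

Negative-side support for the crux `Summit.CriticalPhenomena.PercolationContinuityZ3.Theses.PercLowPointHalfSpace.
LowPointBookkeeping` (K := A → B → C → `τ_{p_c}(0, n e₀) → 0`, with A = `BoundaryTwoArmDecay`,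
B = `TallClusterMassBound`, C = `QuantitativeBGN`), extracted from the standing disprover's work file
`Cruxes/LowPointBookkeeping/Disproof.lean` §0–§2 (refuter cdisprove seat).  Everything is `sorry`-free and nothing
asserts a route statement positively.

* §0 `BookkeepingAt p` — K as the point `p = p_c(ℤ³)` of the one-parameter family
  `TwoArmAt p → MassBoundAt p (11/4) → ArmDecayAt p → AxisDecayAt p` (`lowPointBookkeeping_iff_bookkeepingAt`,
  `Iff.rfl`).
* §1 LOGICAL STATUS: the conclusion of K is EQUIVALENT to the conjunct `θ(p_c(ℤ³)) = 0`
  (`axisDecayAt_criticalProbI_iff`); hence `K ↔ Assembly` (`lowPointBookkeeping_iff_assembly`) and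
  `¬K ↔ A ∧ B ∧ C ∧ ¬PercolationContinuityZ3` (`not_lowPointBookkeeping_iff`): an unconditional refutation of K
  is a proof of a DISCONTINUOUS transition on `ℤ³`; conversely the conjunct alone gives K
  (`not_not_lowPointBookkeeping_of_continuity`), so only a proof THROUGH A, B, C is informative.
* §2 LOAD-BEARING (family level): at `p = 1`, A holds (`twoArmAt_one`: the disjoint two-arm event is null),
  the conclusion fails (`not_axisDecayAt_one`: `τ_1 ≡ 1`), and B, C fail (`not_armDecayAt_one`, landed
  `tallClusterMassBound_false_without_criticality`); hence `bookkeeping_false_without_BC`: no argument valid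
  for every `p` derives the conclusion from A alone.  "K without B" and "K without C" are not separately
  refutable inside the family (wherever the conclusion fails both B and C fail).

References: Grimmett, *Percolation* (1999) §1.3–1.4, §8.5 (`θ² ≤ τ`) [GrimmettPercolation1999];
Barsky–Grimmett–Newman 1991 [BarskyGrimmettNewman1991].
-/

noncomputable section

open MeasureTheory ProbabilityTheory Filter Topology
open Literature.Probability.Percolation Literature.Probability.LatticeModels
open Summit.CriticalPhenomena.PercolationContinuityZ3.Theses.PercLowPointHalfSpace
open Summit.CriticalPhenomena.PercolationContinuityZ3.Theorems
open Summit.CriticalPhenomena.PercolationContinuityZ3.Theorems.TallClusterMassBound.Negative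
  (V3 Hs Pp conn arm armProb MassBoundAt column column_subset_edgeSet reachable_up_of_column up
    setOf_column_subset_arm zero_mem_Hs mem_conn_iff not_forall_rpow_le
    tallClusterMassBound_false_without_criticality)
open Summit.CriticalPhenomena.PercolationContinuityZ3.Theorems.BoundaryTwoArmDecay.Negative
  (E H e adj_zero_e e_ne_zero e_mem_H)

namespace Summit.CriticalPhenomena.PercolationContinuityZ3.Theorems.LowPointBookkeeping.Negative

/-! ## §0 The family `BookkeepingAt p` and the crux as its point `p_c` -/

/-- `AxisDecayAt p`: `P_p(0 ↔ n e₀) → 0` along the normal axis (the conclusion of K at parameter `p`). [folklore] -/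
def AxisDecayAt (p : unitInterval) : Prop :=
  Tendsto (fun n : ℕ => (Pp p).real (openConn (0 : V3) (Pi.single 0 (n : ℤ) : V3))) atTop (𝓝 0)

/-- `TwoArmAt p`: hypothesis A (`BoundaryTwoArmDecay`) at parameter `p`, through the verbatim event
`E r` of `BoundaryTwoArmDecay.Negative.LoadBearing`. [folklore] -/
def TwoArmAt (p : unitInterval) : Prop :=
  ∃ κ C : ℝ, 0 < κ ∧ ∀ r : ℕ, 1 ≤ r → (Pp p).real (E r) ≤ C * (r : ℝ) ^ (-(5 / 2 + κ))

/-- `ArmDecayAt p`: hypothesis C (`QuantitativeBGN`) at parameter `p`. [folklore] -/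
def ArmDecayAt (p : unitInterval) : Prop :=
  ∃ a C : ℝ, 0 < a ∧ ∀ r : ℕ, 1 ≤ r → armProb p r ≤ C * (r : ℝ) ^ (-a)

/-- `BookkeepingAt p`: the crux K with `p_c(ℤ³)` replaced by `p` (B is `MassBoundAt p (11/4)` of
`TallClusterMassBound.Negative.MassExponentFamily`). [folklore] -/
def BookkeepingAt (p : unitInterval) : Prop :=
  TwoArmAt p → MassBoundAt p ((11 : ℝ) / 4) → ArmDecayAt p → AxisDecayAt p

/-- The crux, verbatim, is `BookkeepingAt p_c` (definitional). [folklore] -/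
theorem lowPointBookkeeping_iff_bookkeepingAt :
    LowPointBookkeeping ↔ BookkeepingAt (criticalProbI 3) := Iff.rfl

/-- The conclusion of K is `τ_{p_c}(0, n e₀) → 0` in the tree's two-point notation (definitional). [folklore] -/
theorem axisDecayAt_iff_tau (p : unitInterval) :
    AxisDecayAt p ↔ Tendsto (fun n : ℕ => tau 3 p 0 (Pi.single 0 (n : ℤ))) atTop (𝓝 0) := Iff.rfl

/-! ## §1 Logical status: the conclusion of K is the conjunct; `¬K ⟺ A ∧ B ∧ C ∧ θ(p_c) > 0` -/

/-- **The conclusion of K alone is equivalent to `θ(p_c(ℤ³)) = 0`.**  (→) `θ² ≤ τ` along the axis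
(`LowPoint.percolationContinuityZ3_of_tendsto_openConn`); (←) `τ_{p_c}(0,·) → 0` cofinitely when
`θ(p_c) = 0` (`tendsto_tau_cofinite_of_theta_eq_zero`, a.s. finiteness of `C(0)`), restricted to the
injective axis `n ↦ n e₀`. [folklore] -/
theorem axisDecayAt_criticalProbI_iff :
    AxisDecayAt (criticalProbI 3) ↔ _root_.PercolationContinuityZ3 := by
  constructor
  · intro h
    exact LowPoint.percolationContinuityZ3_of_tendsto_openConn (fun n : ℕ => (Pi.single 0 (n : ℤ) : V3)) h
  · intro h
    have hτ : Tendsto (tau 3 (criticalProbI 3) 0) cofinite (𝓝 0) :=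
      Literature.Barriers.CriticalPhenomena.tendsto_tau_cofinite_of_theta_eq_zero (criticalProbI 3) h
    have hinj : Function.Injective (fun n : ℕ => (Pi.single 0 (n : ℤ) : V3)) := by
      intro m n hmn
      have h0 := congrFun hmn 0
      simp only [Pi.single_eq_same, Nat.cast_inj] at h0
      exact h0
    have h1 := hτ.comp hinj.tendsto_cofinite
    rw [Nat.cofinite_eq_atTop] at h1
    exact h1

/-- **K ⟺ Assembly (stmt-CriticalPhenomena-0915).**  K is the route's assembly with the proved low-point
identity, floor split and floor case folded in; as a STATEMENT it is neither weaker nor stronger. [folklore] -/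
theorem lowPointBookkeeping_iff_assembly : LowPointBookkeeping ↔ Assembly := by
  unfold LowPointBookkeeping Assembly
  exact imp_congr_right fun _ => imp_congr_right fun _ => imp_congr_right fun _ =>
    axisDecayAt_criticalProbI_iff

/-- **Refuting K means proving a discontinuous transition on `ℤ³`.**  `¬K` holds iff A, B, C all hold AND
`θ(p_c(ℤ³)) > 0` (`¬ PercolationContinuityZ3`).  This is why no counterexample search, degenerate case or
small model can touch K itself: its only free content is the conjunct. [folklore] -/
theorem not_lowPointBookkeeping_iff :
    ¬ LowPointBookkeeping ↔
      BoundaryTwoArmDecay ∧ TallClusterMassBound ∧ QuantitativeBGN ∧ ¬ _root_.PercolationContinuityZ3 := by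
  rw [lowPointBookkeeping_iff_assembly]
  unfold Assembly
  simp only [Classical.not_imp]
  exact Iff.rfl

/-- The conjunct alone gives K (so K is "true for free" in the real world if `θ(p_c) = 0`, and a proof of K
that does not pass through A, B, C is a proof of the conjunct).  Stated as a non-implication of the
NEGATIVE lane: `¬K` is impossible under the conjunct. [folklore] -/
theorem not_not_lowPointBookkeeping_of_continuity (h : _root_.PercolationContinuityZ3) :
    ¬ ¬ LowPointBookkeeping := by
  rw [not_lowPointBookkeeping_iff]
  exact fun hK => hK.2.2.2 h

/-! ## §2 Load-bearing analysis in the family `p ↦ BookkeepingAt p`: the point `p = 1` -/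

/-- `P_1` is the point mass at the full lattice configuration. [folklore] -/
theorem Pp_one : Pp 1 = Measure.dirac (zdGraph 3).edgeSet := by
  unfold Pp bondPercolation
  exact setBernoulli_one _

/-- The full lattice configuration joins `0` to `e = (0,1,0)` inside `ℍ` (one open lattice step). [folklore] -/
theorem edgeSet_mem_openConnIn_e : (zdGraph 3).edgeSet ∈ openConnIn H (0 : Site 3) e := by
  have h : (zdGraph 3).edgeSet ∈ conn e := by
    rw [mem_conn_iff]
    refine SimpleGraph.Adj.reachable ?_
    rw [SimpleGraph.inf_adj, openGraph_adj, withinGraph_adj, SimpleGraph.top_adj]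
    exact ⟨⟨(SimpleGraph.mem_edgeSet _).2 adj_zero_e, e_ne_zero.symm⟩, e_ne_zero.symm, zero_mem_Hs, e_mem_H⟩
  exact h

/-- At `p = 1` the disjoint two-arm event is NULL: `P_1(E r) = 0` for every `r` (the roots `0 ∼ e` are
joined by their open edge, so `0 ↮_ℍ e` fails a.s.). [folklore] -/
theorem real_E_one (r : ℕ) : (Pp 1).real (E r) = 0 := by
  have hsub : E r ⊆ (openConnIn H (0 : Site 3) e)ᶜ := fun ω hω => hω.2.2
  have h0 : (Pp 1).real (openConnIn H (0 : Site 3) e)ᶜ = 0 := by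
    rw [measureReal_def, Pp_one,
      Measure.dirac_apply' _ (measurableSet_openConnIn_of_countable _ _ _).compl]
    simp [Set.indicator_of_notMem, edgeSet_mem_openConnIn_e]
  exact le_antisymm ((measureReal_mono hsub).trans h0.le) measureReal_nonneg

/-- **A holds at `p = 1`** (with `κ = 1`, `C = 0`). [folklore] -/
theorem twoArmAt_one : TwoArmAt 1 :=
  ⟨1, 0, one_pos, fun r _ => by rw [real_E_one, zero_mul]⟩

/-- At `p = 1`, `P_1(0 ↔ n e₀) = 1` for every `n` (the open column). [folklore] -/
theorem real_openConn_axis_one (n : ℕ) :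
    (Pp 1).real (openConn (0 : V3) (Pi.single 0 (n : ℤ) : V3)) = 1 := by
  apply le_antisymm measureReal_le_one
  have h := bondPercolation_real_setOf_subset (zdGraph 3) 1 (column n) (column_subset_edgeSet n)
  rw [Set.Icc.coe_one, one_pow] at h
  calc (1 : ℝ) = (Pp 1).real {ω | ↑(column n) ⊆ ω} := by rw [Pp, h]
    _ ≤ _ := measureReal_mono fun ω hω =>
        ((reachable_up_of_column hω le_rfl).mono inf_le_left : (openGraph ω).Reachable 0 (up n))

/-- **The conclusion FAILS at `p = 1`**: `τ_1(0, n e₀) ≡ 1 ↛ 0`. [folklore] -/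
theorem not_axisDecayAt_one : ¬ AxisDecayAt 1 := by
  intro h
  have h1 : Tendsto (fun _ : ℕ => (1 : ℝ)) atTop (𝓝 0) := by
    refine h.congr fun n => ?_
    exact real_openConn_axis_one n
  have h01 := tendsto_nhds_unique h1 tendsto_const_nhds
  norm_num at h01

/-- At `p = 1`, `π_1(r) = 1` for every `r`. [folklore] -/
theorem armProb_one (r : ℕ) : armProb 1 r = 1 := by
  apply le_antisymm (measureReal_le_one)
  have h := bondPercolation_real_setOf_subset (zdGraph 3) 1 (column r) (column_subset_edgeSet r)
  rw [Set.Icc.coe_one, one_pow] at h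
  calc (1 : ℝ) = (Pp 1).real {ω | ↑(column r) ⊆ ω} := by rw [Pp, h]
    _ ≤ armProb 1 r := measureReal_mono (setOf_column_subset_arm r)

/-- **C FAILS at `p = 1`**: `π_1 ≡ 1` is not `O(r^{-a})` for any `a > 0`. [folklore] -/
theorem not_armDecayAt_one : ¬ ArmDecayAt 1 := by
  rintro ⟨a, C, ha, h⟩
  refine not_forall_rpow_le (c := 1) (C := C) (s := -a) (t := 0) one_pos (by linarith) fun r hr => ?_
  have := h r hr
  rw [armProb_one] at this
  simpa [Real.rpow_zero] using this

/-- `BookkeepingAt 1` holds, VACUOUSLY (through ¬B — landed `tallClusterMassBound_false_without_criticality :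
¬ MassBoundAt 1 (11/4)` — or through ¬C). [folklore] -/
theorem bookkeepingAt_one : BookkeepingAt 1 := fun _ hB _ =>
  absurd hB tallClusterMassBound_false_without_criticality

/-- K with BOTH B and C dropped, at parameter `p`. [folklore] -/
def BookkeepingWithoutBC (p : unitInterval) : Prop := TwoArmAt p → AxisDecayAt p

/-- **LOAD-BEARING (family level): B or C must be used.**  `A → conclusion` is false at `p = 1`, so no proof of
K can consume only hypothesis A by an argument insensitive to `p` (A is "free" wherever the two roots are
typically joined; the saturation count `a₂ = 3` says the same at `p_c` heuristically). [folklore] -/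
theorem bookkeeping_false_without_BC : ¬ BookkeepingWithoutBC 1 :=
  fun h => not_axisDecayAt_one (h twoArmAt_one)

/-- The family statement "A suffices at every `p`" is false. [folklore] -/
theorem not_forall_twoArm_imp_axisDecay : ¬ ∀ p : unitInterval, TwoArmAt p → AxisDecayAt p :=
  fun h => bookkeeping_false_without_BC (h 1)

end Summit.CriticalPhenomena.PercolationContinuityZ3.Theorems.LowPointBookkeeping.Negative

end
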